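import Literature.NumberTheory.LFunctions.DobnerSelbergClassLemma3Proofs
import Literature.NumberTheory.LFunctions.DobnerSelbergClassConvexityProofs
import HarnessLib

/-!
# Zero-free right half-plane of `F ∈ 𝒮♯`; the zeros of `ξ^F` lie in a vertical strip (proofs)

RH-FREE literature proofs (no new facts, no `def`s, no instances, no notation). Trunk T-ANT
(`Literature/NumberTheory/LFunctions`); node **T1-d** of the pipeline for
`Literature.NumberTheory.LFunctions.dobner_theorem1` (rt-t4 proposal, rt/STATUS 2026-08-26
08:58:33Z; rt-lead rulings (22)/(26)/(27)). Companion of `DobnerSelbergClass.lean` (the class `𝒮♯`,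
`Literature.NumberTheory.LFunctions.ExtendedSelbergDatum`, `ξ^F = D.xi`, `H_t = D.Ht`), of
`DobnerSelbergClassProofs.lean` (`Literature.NumberTheory.LFunctions.ExtendedSelbergDatum.exists_entire_xi`:
the entire `Ξ^F` with its global functional equation), of `DobnerSelbergClassLemma3Proofs.lean`
(`Literature.NumberTheory.LFunctions.ExtendedSelbergDatum.exists_coeff_ne_zero_ne`) and of
`DobnerSelbergClassConvexityProofs.lean`
(`Literature.NumberTheory.LFunctions.ExtendedSelbergDatum.Gamma_omega_mul_add_mu_ne_zero`).

> A. Dobner, *A proof of Newman's conjecture for the extended Selberg class*, Acta Arith. 201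
> (2021) = arXiv:2005.05142 (held; arXiv page numbers). **Proof of Thm. 1, p. 7**: "To see that
> `𝒵` is nonempty, Theorem 3 shows (by choosing `φ ≔ Φ_F`) that it suffices to check that `H` has
> all of its zeros lying in some horizontal strip, or equivalently that `ξ^F` has all of its zeros
> in some vertical strip. It is a general fact that any convergent Dirichlet series `F` has a
> zero-free half plane because if `s` has large enough real part, then the first term of `F(s)`
> will strictly dominate the sum of all the other terms. This implies `ξ^F` also has a zero-free
> half plane, and so by the functional equation for `ξ^F` all the zeros of `ξ^F` must lie in a
> vertical strip." (Here "the first term" is the first NON-ZERO term `a_{n₀} n₀^{−s}`; `k ≥ 1`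
> guarantees a non-zero coefficient, `exists_coeff_ne_zero_ne`.) **p. 6**: "`H(z) ≔ ξ^F((1+iz)/2)`,
> so that values of `ξ^F` on the critical line correspond to values of `H` on the real line."

## Main results (all `theorem`s; `D : ExtendedSelbergDatum`, `k = D.numGamma ≥ 1`)

* `ExtendedSelbergDatum.exists_toFun_ne_zero_of_re_gt` — **zero-free half-plane of `F`**:
  `∃ σ₀, ∀ s, σ₀ < Re s → F(s) ≠ 0`;
* `ExtendedSelbergDatum.gamma_ne_zero_of_one_lt_re`, `…exists_xi_ne_zero_of_re_gt` — the same for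
  `γ` (on `Re s > 1`) and for `ξ^F = γF`;
* `ExtendedSelbergDatum.exists_abs_re_sub_half_le_of_entire_xi` — **the zeros of `Ξ^F` lie in a
  vertical strip**: for every `Ξ` agreeing with `ξ^F` on `{Re s > 0} ∖ {1}` and satisfying the
  global functional equation `Ξ(s) = conj Ξ(1 − conj s)` (the specification of `exists_entire_xi`),
  `∃ K ≥ 0, ∀ s, Ξ s = 0 → |Re s − ½| ≤ K`;
* `ExtendedSelbergDatum.exists_rootsInStrip_Ht_zero_of` — **bridge to de Bruijn's Thm. 13**
  (`Literature.Analysis.Complex.RootsInStrip`) in HYPOTHESIS FORM: if `H_0(z) = Ξ((1+iz)/2)` for the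
  entire `Ξ` of that specification (node T1-c: Fourier inversion), then `RootsInStrip (D.Ht 0) Δ`
  for some `Δ ≥ 0`.

## Proof route (as printed)

First non-zero coefficient dominates: with `n₀` minimal such that `a_{n₀} ≠ 0` and
`S = ∑ ‖aₙ‖ n^{−2}` ((i) at `s = 2`), for `σ = Re s ≥ 2` the other terms have modulus
`≤ ∑_{n > n₀} ‖aₙ‖ n^{−2} n^{−(σ−2)} ≤ (n₀+1)^{−(σ−2)} S`, while `|a_{n₀} n₀^{−s}| = ‖a_{n₀}‖ n₀^{−2}
n₀^{−(σ−2)}`; since `(n₀/(n₀+1))^{σ−2} → 0` the first term wins for `σ > σ₀`. Then `γ ≠ 0` on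
`Re s > 1` (no pole or zero of `sᵐ(s−1)ᵐQˢ∏Γ(ωᵢs+μᵢ)` there), the functional equation reflects
the zero-free half-plane `Re s > σ₁` to `Re s < 1 − σ₁`, and `Re((1+iz)/2) = (1 − Im z)/2`.

Bytes: rt-t6 g3 (banked 2026-08-26T09:20Z as HOME/drafts/rt/t6-T1d-DobnerSelbergClassZeroFreeProofs-GREEN.lean,
sha16 5b001d2ed13016a3, farm-green); filed unchanged (this credit paragraph added) by rt-iso g5 per
rt-lead ruling (38)(a), rt/STATUS 2026-08-26T09:57:27Z. Consumer: the T1 leaf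
(`ExtendedSelbergDatum.exists_rootsInStrip_Ht_zero`, `dobner_theorem1_holds`).

bears_on: N-C/N-P (COLUMN 3 DBN). WHAT THIS IS NOT: locating the zeros of a completed `𝒮♯`
L-function in SOME vertical strip is classical RH-free bookkeeping — it says nothing about the
critical line; nothing here bears on the truth of RH.
-/

noncomputable section

open Complex Filter Set Topology ComplexConjugate

namespace Literature.NumberTheory.LFunctions

namespace ExtendedSelbergDatum

variable (D : ExtendedSelbergDatum)

/-! ### The zero-free right half-plane of `F` -/

/-- Modulus of the `n`-th Dirichlet term on `Re s = σ`: `‖aₙ n^{−s}‖ = ‖aₙ‖ n^{−σ}` (`n ≥ 1`).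
[cite: Dobner2021, §2 (i) p. 5] -/
theorem norm_term_coeff_eq {n : ℕ} (hn : n ≠ 0) (s : ℂ) :
    ‖LSeries.term D.coeff s n‖ = ‖D.coeff n‖ * (n : ℝ) ^ (-s.re) := by
  rw [LSeries.term_of_ne_zero hn, norm_div, Complex.norm_natCast_cpow_of_pos (Nat.pos_of_ne_zero hn),
    Real.rpow_neg (Nat.cast_nonneg n), div_eq_mul_inv]

/-- **`F` is non-vanishing in some right half-plane** (`k ≥ 1`): there is `σ₀` with `F(s) ≠ 0` for
`Re s > σ₀` — "if `s` has large enough real part, then the first term of `F(s)` will strictly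
dominate the sum of all the other terms" (the first NON-ZERO term `a_{n₀} n₀^{−s}`; a non-zero
coefficient exists by `exists_coeff_ne_zero_ne`). [cite: Dobner2021, proof of Thm. 1, p. 7] -/
theorem exists_toFun_ne_zero_of_re_gt (hk : 0 < D.numGamma) :
    ∃ σ₀ : ℝ, ∀ s : ℂ, σ₀ < s.re → D.toFun s ≠ 0 := by
  classical
  obtain ⟨n₁, hn₁0, -, hn₁⟩ := D.exists_coeff_ne_zero_ne hk 0
  have hex : ∃ n : ℕ, n ≠ 0 ∧ D.coeff n ≠ 0 := ⟨n₁, hn₁0, hn₁⟩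
  set n₀ : ℕ := Nat.find hex with hn₀def
  have hn₀ : n₀ ≠ 0 ∧ D.coeff n₀ ≠ 0 := Nat.find_spec hex
  have hmin : ∀ n : ℕ, n < n₀ → n ≠ 0 → D.coeff n = 0 := fun n hn hn0 ↦ by
    by_contra h
    exact Nat.find_min hex hn ⟨hn0, h⟩
  have hn₀pos : (0 : ℝ) < n₀ := by exact_mod_cast Nat.pos_of_ne_zero hn₀.1
  -- `S = ∑ ‖aₙ‖ n^{-2}`
  set S : ℝ := ∑' n : ℕ, ‖LSeries.term D.coeff 2 n‖ with hSdef
  have hSsum : Summable fun n : ℕ ↦ ‖LSeries.term D.coeff 2 n‖ := (D.summable 2 (by norm_num)).norm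
  have hS0 : 0 ≤ S := tsum_nonneg fun n ↦ norm_nonneg _
  -- the ratio `q = n₀/(n₀+1) < 1` and the size `c = ‖a_{n₀}‖ n₀^{-2}` of the leading term at `σ = 2`
  set q : ℝ := n₀ / (n₀ + 1) with hqdef
  have hq0 : 0 < q := by positivity
  have hq1 : q < 1 := by rw [hqdef, div_lt_one (by positivity)]; linarith
  set c : ℝ := ‖D.coeff n₀‖ * (n₀ : ℝ) ^ (-2 : ℝ) with hcdef
  have hc0 : 0 < c := mul_pos (norm_pos_iff.2 hn₀.2) (Real.rpow_pos_of_pos hn₀pos _)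
  -- choose `X` with `q^x S < c` for `x ≥ X`
  have hlim : Tendsto (fun x : ℝ ↦ q ^ x * S) atTop (𝓝 0) := by
    simpa using (tendsto_rpow_atTop_of_base_lt_one q (by linarith) hq1).mul_const S
  obtain ⟨X, hX⟩ := eventually_atTop.1 (hlim.eventually (gt_mem_nhds hc0))
  refine ⟨max 2 (X + 2), fun s hs hF ↦ ?_⟩
  have hσ2 : 2 < s.re := lt_of_le_of_lt (le_max_left _ _) hs
  have hσX : X ≤ s.re - 2 := by linarith [le_max_right 2 (X + 2)]
  set σ : ℝ := s.re with hσdef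
  -- `F(s) = ∑ aₙ n^{-s}` on `Re s > 1`
  have hsum : Summable (LSeries.term D.coeff s) := D.summable s (by linarith)
  have hF' : LSeries D.coeff s = 0 := by
    rw [← D.eqOn_LSeries (show s ∈ {s : ℂ | 1 < s.re} by simp; linarith)]; exact hF
  rw [LSeries, hsum.tsum_eq_add_tsum_ite n₀] at hF'
  -- the other terms: `‖·‖ ≤ (n₀+1)^{-(σ-2)} ‖term at 2‖`
  have hrest_le : ∀ n : ℕ, ‖ite (n = n₀) 0 (LSeries.term D.coeff s n)‖ ≤
      ((n₀ : ℝ) + 1) ^ (-(σ - 2)) * ‖LSeries.term D.coeff 2 n‖ := by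
    intro n
    have hR0 : 0 ≤ ((n₀ : ℝ) + 1) ^ (-(σ - 2)) * ‖LSeries.term D.coeff 2 n‖ := by positivity
    by_cases hnn : n = n₀
    · rw [if_pos hnn, norm_zero]; exact hR0
    rw [if_neg hnn]
    rcases Nat.eq_zero_or_pos n with rfl | hnpos
    · rw [LSeries.term_zero, norm_zero]; exact hR0
    rcases lt_or_gt_of_ne hnn with hlt | hgt
    · rw [LSeries.term_of_ne_zero hnpos.ne', hmin n hlt hnpos.ne', zero_div, norm_zero]; exact hR0
    · have hn1 : ((n₀ : ℝ) + 1) ≤ n := by exact_mod_cast hgt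
      have hnpos' : (0 : ℝ) < n := by exact_mod_cast hnpos
      rw [D.norm_term_coeff_eq hnpos.ne', D.norm_term_coeff_eq hnpos.ne', Complex.re_ofNat]
      have e : (n : ℝ) ^ (-σ) = (n : ℝ) ^ (-(2 : ℝ)) * (n : ℝ) ^ (-(σ - 2)) := by
        rw [← Real.rpow_add hnpos']; congr 1; ring
      rw [← hσdef, e]
      have hmono : (n : ℝ) ^ (-(σ - 2)) ≤ ((n₀ : ℝ) + 1) ^ (-(σ - 2)) :=
        Real.rpow_le_rpow_of_nonpos (by positivity) hn1 (by linarith)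
      have h0 : 0 ≤ ‖D.coeff n‖ * (n : ℝ) ^ (-(2 : ℝ)) := by positivity
      calc ‖D.coeff n‖ * ((n : ℝ) ^ (-(2 : ℝ)) * (n : ℝ) ^ (-(σ - 2)))
          = ‖D.coeff n‖ * (n : ℝ) ^ (-(2 : ℝ)) * (n : ℝ) ^ (-(σ - 2)) := by ring
        _ ≤ ‖D.coeff n‖ * (n : ℝ) ^ (-(2 : ℝ)) * ((n₀ : ℝ) + 1) ^ (-(σ - 2)) :=
            mul_le_mul_of_nonneg_left hmono h0
        _ = ((n₀ : ℝ) + 1) ^ (-(σ - 2)) * (‖D.coeff n‖ * (n : ℝ) ^ (-(2 : ℝ))) := by ring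
  have hrest_sum : Summable fun n : ℕ ↦ ‖ite (n = n₀) 0 (LSeries.term D.coeff s n)‖ :=
    Summable.of_nonneg_of_le (fun n ↦ norm_nonneg _) hrest_le (hSsum.mul_left _)
  have hrest : ‖∑' n : ℕ, ite (n = n₀) 0 (LSeries.term D.coeff s n)‖ ≤
      ((n₀ : ℝ) + 1) ^ (-(σ - 2)) * S := by
    calc ‖∑' n : ℕ, ite (n = n₀) 0 (LSeries.term D.coeff s n)‖
        ≤ ∑' n : ℕ, ‖ite (n = n₀) 0 (LSeries.term D.coeff s n)‖ := norm_tsum_le_tsum_norm hrest_sum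
      _ ≤ ∑' n : ℕ, ((n₀ : ℝ) + 1) ^ (-(σ - 2)) * ‖LSeries.term D.coeff 2 n‖ :=
          Summable.tsum_le_tsum hrest_le hrest_sum (hSsum.mul_left _)
      _ = ((n₀ : ℝ) + 1) ^ (-(σ - 2)) * S := by rw [tsum_mul_left]
  -- the leading term
  have hlead : ‖LSeries.term D.coeff s n₀‖ = c * (n₀ : ℝ) ^ (-(σ - 2)) := by
    rw [D.norm_term_coeff_eq hn₀.1, ← hσdef,
      show c * (n₀ : ℝ) ^ (-(σ - 2)) = ‖D.coeff n₀‖ * ((n₀ : ℝ) ^ (-2 : ℝ) * (n₀ : ℝ) ^ (-(σ - 2))) by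
        rw [hcdef]; ring,
      ← Real.rpow_add hn₀pos]
    congr 2; ring
  -- from `term n₀ = -(rest)`: `c n₀^{-(σ-2)} ≤ (n₀+1)^{-(σ-2)} S`, i.e. `c ≤ q^{σ-2} S < c`
  have heq : LSeries.term D.coeff s n₀ = -∑' n : ℕ, ite (n = n₀) 0 (LSeries.term D.coeff s n) :=
    eq_neg_of_add_eq_zero_left hF'
  have hq : ((n₀ : ℝ) + 1) ^ (-(σ - 2)) = q ^ (σ - 2) * (n₀ : ℝ) ^ (-(σ - 2)) := by
    rw [hqdef, Real.div_rpow hn₀pos.le (by positivity), Real.rpow_neg (by positivity),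
      Real.rpow_neg hn₀pos.le]
    field_simp
  have hpow0 : 0 < (n₀ : ℝ) ^ (-(σ - 2)) := Real.rpow_pos_of_pos hn₀pos _
  have hle2 : c * (n₀ : ℝ) ^ (-(σ - 2)) ≤ (q ^ (σ - 2) * S) * (n₀ : ℝ) ^ (-(σ - 2)) := by
    calc c * (n₀ : ℝ) ^ (-(σ - 2)) = ‖LSeries.term D.coeff s n₀‖ := hlead.symm
      _ = ‖∑' n : ℕ, ite (n = n₀) 0 (LSeries.term D.coeff s n)‖ := by rw [heq, norm_neg]
      _ ≤ ((n₀ : ℝ) + 1) ^ (-(σ - 2)) * S := hrest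
      _ = (q ^ (σ - 2) * S) * (n₀ : ℝ) ^ (-(σ - 2)) := by rw [hq]; ring
  have hle' : c ≤ q ^ (σ - 2) * S := le_of_mul_le_mul_right hle2 hpow0
  have hlt : q ^ (σ - 2) * S < c := hX (σ - 2) hσX
  linarith

/-- `γ(s) ≠ 0` for `Re s > 1` (`α ≠ 0`, `s ≠ 0, 1`, `Qˢ ≠ 0`, no `Γ(ωᵢ s + μᵢ)` vanishes).
[cite: Dobner2021, §2 (iii) p. 5] -/
theorem gamma_ne_zero_of_one_lt_re {s : ℂ} (hs : 1 < s.re) : D.gamma s ≠ 0 := by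
  have h0 : s ≠ 0 := fun h ↦ by rw [h, Complex.zero_re] at hs; linarith
  have h1 : s - 1 ≠ 0 := fun h ↦ by
    have := congrArg Complex.re h
    rw [Complex.sub_re, Complex.one_re, Complex.zero_re] at this
    linarith
  rw [gamma, dobnerGamma_apply]
  refine mul_ne_zero (mul_ne_zero (mul_ne_zero (mul_ne_zero D.alpha_ne_zero (pow_ne_zero _ h0))
    (pow_ne_zero _ h1)) ?_) ?_
  · rw [Ne, Complex.cpow_eq_zero_iff, not_and_or]
    exact Or.inl (by exact_mod_cast D.Q_pos.ne')
  · exact Finset.prod_ne_zero_iff.2 fun i _ ↦ D.Gamma_omega_mul_add_mu_ne_zero s (by linarith) i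

/-- **`ξ^F` is non-vanishing in some right half-plane** (`k ≥ 1`): there is `σ₁ ≥ 1` with
`ξ^F(s) ≠ 0` for `Re s > σ₁`. [cite: Dobner2021, proof of Thm. 1, p. 7] -/
theorem exists_xi_ne_zero_of_re_gt (hk : 0 < D.numGamma) :
    ∃ σ₁ : ℝ, 1 ≤ σ₁ ∧ ∀ s : ℂ, σ₁ < s.re → D.xi s ≠ 0 := by
  obtain ⟨σ₀, hσ₀⟩ := D.exists_toFun_ne_zero_of_re_gt hk
  refine ⟨max σ₀ 1, le_max_right _ _, fun s hs ↦ ?_⟩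
  rw [xi_apply]
  exact mul_ne_zero (D.gamma_ne_zero_of_one_lt_re (lt_of_le_of_lt (le_max_right _ _) hs))
    (hσ₀ s (lt_of_le_of_lt (le_max_left _ _) hs))

/-! ### The zeros of the entire `Ξ^F` lie in a vertical strip -/

/-- **All zeros of `Ξ^F` lie in a vertical strip `|Re s − ½| ≤ K`** (`k ≥ 1`), for every `Ξ`
agreeing with `ξ^F = γF` on `{Re s > 0} ∖ {1}` and satisfying the global functional equation
`Ξ(s) = conj Ξ(1 − conj s)` (the specification of `exists_entire_xi`): the zero-free half-plane
`Re s > σ₁` is reflected to `Re s < 1 − σ₁`. [cite: Dobner2021, proof of Thm. 1, p. 7] -/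
theorem exists_abs_re_sub_half_le_of_entire_xi (hk : 0 < D.numGamma) {Ξ : ℂ → ℂ}
    (hΞxi : ∀ s : ℂ, 0 < s.re → s ≠ 1 → Ξ s = D.xi s)
    (hΞfe : ∀ s : ℂ, Ξ s = conj (Ξ (1 - conj s))) :
    ∃ K : ℝ, 0 ≤ K ∧ ∀ s : ℂ, Ξ s = 0 → |s.re - 1 / 2| ≤ K := by
  obtain ⟨σ₁, hσ₁, hne⟩ := D.exists_xi_ne_zero_of_re_gt hk
  refine ⟨σ₁ - 1 / 2, by linarith, fun s hs ↦ ?_⟩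
  -- right half-plane
  have hright : ∀ w : ℂ, σ₁ < w.re → Ξ w ≠ 0 := by
    intro w hw
    have hw1 : w ≠ 1 := fun h ↦ by rw [h, Complex.one_re] at hw; linarith
    rw [hΞxi w (by linarith) hw1]
    exact hne w hw
  rw [abs_le]
  constructor
  · -- `Re s ≥ 1 - σ₁`: otherwise `1 - conj s` lies in the zero-free half-plane
    by_contra hlt
    push Not at hlt
    have hre : σ₁ < (1 - conj s).re := by
      simp only [Complex.sub_re, Complex.one_re, Complex.conj_re]
      linarith
    have h1 := hright _ hre
    rw [hΞfe s] at hs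
    exact h1 (by simpa using hs)
  · by_contra hlt
    push Not at hlt
    exact hright s (by linarith) hs

/-- **Bridge to de Bruijn's Thm. 13** (hypothesis form; `k ≥ 1`): if `H_0(z) = Ξ^F((1+iz)/2)` on
`ℂ` for every entire `Ξ^F` of the specification of `exists_entire_xi` (node T1-c: Fourier
inversion, p. 6), then all roots of `H_0` lie in a horizontal strip `|Im z| ≤ Δ`
(`Re((1+iz)/2) = (1 − Im z)/2`). [cite: Dobner2021, proof of Thm. 1, pp. 6–7] -/
theorem exists_rootsInStrip_Ht_zero_of (hk : 0 < D.numGamma)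
    (hH0 : ∀ Ξ : ℂ → ℂ, Differentiable ℂ Ξ → (∀ s : ℂ, 0 < s.re → s ≠ 1 → Ξ s = D.xi s) →
      (∀ s : ℂ, Ξ s = conj (Ξ (1 - conj s))) → ∀ z : ℂ, D.Ht 0 z = Ξ ((1 + I * z) / 2)) :
    ∃ Δ : ℝ, 0 ≤ Δ ∧ Literature.Analysis.Complex.RootsInStrip (D.Ht 0) Δ := by
  obtain ⟨Ξ, hΞd, hΞxi, hΞfe⟩ := D.exists_entire_xi
  obtain ⟨K, hK0, hK⟩ := D.exists_abs_re_sub_half_le_of_entire_xi hk hΞxi hΞfe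
  refine ⟨2 * K, by positivity, fun z hz ↦ ?_⟩
  rw [hH0 Ξ hΞd hΞxi hΞfe z] at hz
  have h := hK _ hz
  have hre : ((1 + I * z) / 2 : ℂ).re = (1 - z.im) / 2 := by
    have e : ((1 + I * z) / 2 : ℂ) = (((1 - z.im) / 2 : ℝ) : ℂ) + ((z.re / 2 : ℝ) : ℂ) * I := by
      apply Complex.ext
      · simp; ring
      · simp
    rw [e]; simp
  rw [hre, show (1 - z.im) / 2 - 1 / 2 = -(z.im / 2) by ring, abs_neg, abs_div, abs_two] at h
  linarith

end ExtendedSelbergDatum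

end Literature.NumberTheory.LFunctions

end
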